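import Summits.QuantumFields.QCD.Theorems.QuarksAsStableActionCriticalLineDiamagnetismRectFreqOpDefs
import Summits.QuantumFields.QCD.Theorems.QuarksAsStableActionCriticalLineDiamagnetismCellKappaDefs

/-!
# The cell objects of the B6 cell lemma (crux `stmt-QuantumFields-9734`, line `Sketch`, Route B)

Sub-problem context: `Summits/QuantumFields/QCD/Statement.lean`; crux decl
`Summit.QuantumFields.QCD.Theses.QuarksAsStableAction.CriticalLineDiamagnetism`; serves the registered stubs
`cellLemma` ⟵ `cellInvert`, `cellFirstOrder`, `cellSecondOrder` of `stub_heavyFrequencyGain`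
(plan `work/odd/S4-PLAN.md` §B6 of the line lead).

DEFINITIONS ONLY.  The checkerboard of one plaquette `P ∈ U(3)` on the even two-torus `(ℤ/2n)²`: the
first-coordinate links based at sites with ODD second coordinate carry `P` (even first coordinate) resp. `P⁻¹` (odd
first coordinate); all other links are trivial.  Every plaquette of this field is a conjugate of `P` or `P⁻¹`, so its
deficit is `def(P) = 3 − Re tr P` everywhere.  `D_P := freqOpR γ chk`, `D_1 :=` the free operator, `X := D_1⁻¹(D_P − D_1)`
(so `det D_P = det D_1 · det(1 + X)` once `D_1` is invertible), and `alphaTor` is the colour-averaged spin trace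
`−(1/3) Σ_c tr₄[G((1,0),(0,0))_{cc} · P₋²]` of the free torus propagator across the reference link `(0,0) → (1,0)` — the torus
counterpart of `CellKappa.kappaOne` (which is `−Re tr[g_J(1,0) P₋²]` for the PLANAR propagator truncated at `J` steps).
-/

noncomputable section

open scoped BigOperators Matrix
open Matrix Literature.MathematicalPhysics.QuantumLattice
open Summit.QuantumFields.QCD.Cruxes.CriticalLineDiamagnetism.ChessboardCellGain.FrequencyDiamagnetism

namespace Summit.QuantumFields.QCD.Cruxes.CriticalLineDiamagnetism.ChessboardCellGain.Cell

/-- The checkerboard field of the plaquette `P` on `(ℤ/2n)²` (see the module docstring). -/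
def chk (n : ℕ) (P : Matrix.unitaryGroup (Fin 3) ℂ) : ZMod (2 * n) → ZMod (2 * n) → Fin 4 → Matrix.unitaryGroup (Fin 3) ℂ :=
  fun a b μ => if μ = 2 ∧ b.val % 2 = 1 then (if a.val % 2 = 0 then P else P⁻¹) else 1

/-- The plaquette deficit `def(P) = 3 − Re tr P`. -/
def defi (P : Matrix.unitaryGroup (Fin 3) ℂ) : ℝ := 3 - ((P : Matrix (Fin 3) (Fin 3) ℂ).trace).re

/-- The free 2D frequency operator on `(ℤ/2n)²`. -/
def D1 (n : ℕ) [NeZero n] (m ω₀ ω₁ : ℝ) :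
    Matrix ((ZMod (2 * n) × ZMod (2 * n)) × Fin 3 × Fin 4) ((ZMod (2 * n) × ZMod (2 * n)) × Fin 3 × Fin 4) ℂ :=
  freqOpR euclideanGamma (fun (_ _ : ZMod (2 * n)) (_ : Fin 4) => (1 : Matrix.unitaryGroup (Fin 3) ℂ)) m ω₀ ω₁

/-- The 2D frequency operator of the checkerboard field of `P`. -/
def DP (n : ℕ) [NeZero n] (P : Matrix.unitaryGroup (Fin 3) ℂ) (m ω₀ ω₁ : ℝ) :
    Matrix ((ZMod (2 * n) × ZMod (2 * n)) × Fin 3 × Fin 4) ((ZMod (2 * n) × ZMod (2 * n)) × Fin 3 × Fin 4) ℂ :=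
  freqOpR euclideanGamma (chk n P) m ω₀ ω₁

/-- The perturbation operator `X = D_1⁻¹ (D_P − D_1)`. -/
def X (n : ℕ) [NeZero n] (P : Matrix.unitaryGroup (Fin 3) ℂ) (m ω₀ ω₁ : ℝ) :
    Matrix ((ZMod (2 * n) × ZMod (2 * n)) × Fin 3 × Fin 4) ((ZMod (2 * n) × ZMod (2 * n)) × Fin 3 × Fin 4) ℂ :=
  (D1 n m ω₀ ω₁)⁻¹ * (DP n P m ω₀ ω₁ - D1 n m ω₀ ω₁)

/-- The torus link amplitude `α = −(1/3) Σ_c Σ_{ij} G((1,0),c,i),((0,0),c,j) · (P₋²)_{ji}` of the free propagator `G = D_1⁻¹`. -/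
def alphaTor (n : ℕ) [NeZero n] (m ω₀ ω₁ : ℝ) : ℂ :=
  -(1 / 3 : ℂ) * ∑ c : Fin 3, ∑ i : Fin 4, ∑ j : Fin 4,
    (D1 n m ω₀ ω₁)⁻¹ (((1, 0), c, i)) (((0, 0), c, j)) * CellKappa.pMinus 2 j i

/-- The heavy mass parameter `M_ω = m + 4 − cos ω₀ − cos ω₁`. -/
def bigM (m ω₀ ω₁ : ℝ) : ℝ := m + 4 - Real.cos ω₀ - Real.cos ω₁

/-- Landing anchor of this definitions file: the checkerboard field has trivial second-coordinate links. -/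
theorem cellDefs_anchor : ∀ (n : ℕ) (P : Matrix.unitaryGroup (Fin 3) ℂ) (a b : ZMod (2 * n)), chk n P a b 3 = 1 :=
  fun _ _ _ _ => if_neg fun h => absurd h.1 (by decide)

end Summit.QuantumFields.QCD.Cruxes.CriticalLineDiamagnetism.ChessboardCellGain.Cell
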